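import Summits.QuantumFields.YangMills.Theorems.BalabanUVNodesPortS1G3CPoint

/-!
# NODE O port PT-A — `stub_G3C` (repaired edition `G3CAtRecordL`), layer (α): THE OPEN NEIGHBOURHOOD `O_X ⊇ S_X` ON WHICH THE POINT PREDICATE HOLDS WITH DEGRADED CONSTANTS
# `(2c₀, γ₀∕2)` and every entry of every piece `T_Y`, `Y ⊆ X`, is analytic — the set on which rows (g2)(g3)(g5) of `G3CPiecesAt` will be verified

Cell `ym-nodeO-ideate`, porter hand `hand-27930-G3C` (g1); `--supports stmt-QuantumFields-27930`; count-neutral.  [I] = [Balaban1987RG1], [B9] = [Balaban1985BackgroundPropagators],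
[15] = [Balaban1985Variational].

WHY (memo §5c, row (g2)(g3)(g5)).  The record space `S_X := {φ | encodeCfg φ ∈ U^c(X)}` has empty interior, and `G3CPiecesAt` asks holomorphy ∕ the bound ∕ x-continuity on an OPEN
`O ⊇ S_X`.  At `φ₀ ∈ S_X` the body gives (P4) analyticity of the finitely many entries `ψ ↦ T_Y(ψ) i j`, `Y ⊆ X` (at `φ₀ ∈ S_X ⊆ S_Y`, ✓`recordUc_antitone`), the lattice rows∕columns
(P4-lat) with `c₀` and the coercivity (P5ᶜ) with `γ₀`; by continuity of finitely many entries, on a neighbourhood of `φ₀` every entry moves by at most `η_Y`, with `η_Y` so small that the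
weighted rows∕columns stay `≤ 2c₀·e^{−δ₀d_j(Y)}` and the quadratic forms of the blocks `T^{(Z)}|_Z`, `Z ⊆ X`, lose at most `γ₀∕2`.  `O_X` is the union over `φ₀ ∈ S_X` of the interiors
of these neighbourhoods.

WHAT THIS FILE PROVES (sorry-free): generic `G3CCT.norm_form_le_of_entry_le` (`|⟨z, Dz⟩| ≤ ε·#ι·‖z‖²` for `‖D a b‖ ≤ ε`), `G3CCT.reCoercive_of_near` (coercivity survives an entrywise
`ε`-perturbation with `ε·#ι ≤ γ∕2`), `G3CCT.weightedRowSum_le_of_near`; ★★ `exists_open_g3cPt` — `∃ O` open, `S_X ⊆ O`, `∀ φ ∈ O, G3CPt … (2c₀) (γ₀∕2) δ₀ δ₁ X φ ∧` analyticity at `φ`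
of every entry of every `T_Y`, `Y ⊆ X`.

HONEST FRAMING.  Finite-dimensional continuity bookkeeping under the HYPOTHESES `P0CarrierClauses …` ∕ `P0CarrierLatticeDecay …` (inhabited nowhere); nothing of Bałaban asserted,
ported or discharged; `stub_G3C` NOT closed; 27930 OPEN; NODE O 0∕1; COUNT 8∕28 · K 1∕4 UNMOVED; finite `𝕋⁴_{L^K}` at fixed ε — NOT continuum ∕ OS ∕ Clay; **the Yang–Mills mass gap
is NOT proved by any of this.**  No `sorry`, no `instance`, no `notation`; standard axioms.
-/

noncomputable section

open scoped BigOperators Matrix.Norms.L2Operator Topology Matrix Classical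
open Filter Finset

/-! ## Generic: entrywise perturbation of quadratic forms and weighted Schur sums -/

namespace Summit.QuantumFields.YangMills.Theorems.BalabanUVNodesPortS1.G3CCT

open Literature.MathematicalPhysics.QuantumFieldTheory.Balaban1983to89.B5Prop11Lower (nsq nsq_nonneg)

variable {ι : Type*} [Fintype ι]

/-- `|⟨z, D z⟩| ≤ ε·#ι·Σ‖z_a‖²` when every entry of `D` has norm `≤ ε` (Cauchy–Schwarz `(Σ‖z_a‖)² ≤ #ι·Σ‖z_a‖²`). [folklore] -/
theorem norm_form_le_of_entry_le (D : Matrix ι ι ℂ) {ε : ℝ} (hε : 0 ≤ ε) (hD : ∀ a b, ‖D a b‖ ≤ ε) (z : ι → ℂ) :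
    ‖star z ⬝ᵥ (D *ᵥ z)‖ ≤ ε * Fintype.card ι * nsq z := by
  have h1 : ‖star z ⬝ᵥ (D *ᵥ z)‖ ≤ ∑ a, ‖z a‖ * (ε * ∑ b, ‖z b‖) := by
    rw [dotProduct]
    refine (norm_sum_le _ _).trans (Finset.sum_le_sum fun a _ => ?_)
    rw [Pi.star_apply, norm_mul, norm_star, Matrix.mulVec, dotProduct]
    refine mul_le_mul_of_nonneg_left ((norm_sum_le _ _).trans ?_) (norm_nonneg _)
    rw [Finset.mul_sum]
    exact Finset.sum_le_sum fun b _ => by rw [norm_mul]; exact mul_le_mul_of_nonneg_right (hD a b) (norm_nonneg _)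
  have h2 : ∑ a, ‖z a‖ * (ε * ∑ b, ‖z b‖) = ε * (∑ a, ‖z a‖) ^ 2 := by rw [← Finset.sum_mul]; ring
  have h3 : (∑ a, ‖z a‖) ^ 2 ≤ Fintype.card ι * ∑ a, ‖z a‖ ^ 2 := by
    have := sq_sum_le_card_mul_sum_sq (s := (Finset.univ : Finset ι)) (f := fun a => ‖z a‖)
    simpa using this
  calc ‖star z ⬝ᵥ (D *ᵥ z)‖ ≤ ε * (∑ a, ‖z a‖) ^ 2 := h1.trans h2.le
    _ ≤ ε * (Fintype.card ι * ∑ a, ‖z a‖ ^ 2) := mul_le_mul_of_nonneg_left h3 hε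
    _ = ε * Fintype.card ι * nsq z := by rw [nsq]; ring

/-- **`Re`-coercivity survives a small entrywise perturbation**: `γ‖z‖² ≤ Re⟨z, M₀z⟩`, `‖M a b − M₀ a b‖ ≤ ε`, `ε·#ι ≤ γ∕2` ⟹ `(γ∕2)‖z‖² ≤ Re⟨z, Mz⟩`. [folklore] -/
theorem reCoercive_of_near (M₀ M : Matrix ι ι ℂ) {γ ε : ℝ} (hε : 0 ≤ ε) (hco : ∀ z : ι → ℂ, γ * nsq z ≤ (star z ⬝ᵥ (M₀ *ᵥ z)).re)
    (hD : ∀ a b, ‖M a b - M₀ a b‖ ≤ ε) (hεγ : ε * Fintype.card ι ≤ γ / 2) (z : ι → ℂ) :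
    γ / 2 * nsq z ≤ (star z ⬝ᵥ (M *ᵥ z)).re := by
  have hsplit : M = M₀ + (M - M₀) := by abel
  have hform : star z ⬝ᵥ (M *ᵥ z) = star z ⬝ᵥ (M₀ *ᵥ z) + star z ⬝ᵥ ((M - M₀) *ᵥ z) := by
    conv_lhs => rw [hsplit]
    rw [Matrix.add_mulVec, dotProduct_add]
  rw [hform, Complex.add_re]
  have hpert : ‖star z ⬝ᵥ ((M - M₀) *ᵥ z)‖ ≤ ε * Fintype.card ι * nsq z :=
    norm_form_le_of_entry_le (M - M₀) hε (fun a b => by simpa [Matrix.sub_apply] using hD a b) z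
  have hre : -(ε * Fintype.card ι * nsq z) ≤ (star z ⬝ᵥ ((M - M₀) *ᵥ z)).re :=
    (neg_le_neg hpert).trans (neg_le_of_abs_le (Complex.abs_re_le_norm _))
  have hz := nsq_nonneg z
  have h0 := hco z
  nlinarith [mul_le_mul_of_nonneg_right hεγ hz]

/-- **Weighted Schur sums survive a small entrywise perturbation**: `Σ_j ‖A₀ i j‖·w i j ≤ b`, `‖A i j − A₀ i j‖ ≤ η`, `Σ_j w i j ≤ S`, `η·S ≤ b` ⟹ `Σ_j ‖A i j‖·w i j ≤ 2b`. [folklore] -/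
theorem weightedRowSum_le_of_near {κ : Type*} (s : Finset κ) (A A₀ : κ → ℂ) (w : κ → ℝ) (hw : ∀ j, 0 ≤ w j) {S η b : ℝ} (hη : 0 ≤ η)
    (hS : ∑ j ∈ s, w j ≤ S) (hA₀ : ∑ j ∈ s, ‖A₀ j‖ * w j ≤ b) (hnear : ∀ j, ‖A j - A₀ j‖ ≤ η) (hηS : η * S ≤ b) :
    ∑ j ∈ s, ‖A j‖ * w j ≤ 2 * b := by
  have h1 : ∀ j, ‖A j‖ ≤ ‖A₀ j‖ + η := fun j => by
    have := norm_le_norm_add_norm_sub' (A j) (A₀ j)  -- ‖A j‖ ≤ ‖A₀ j‖ + ‖A j - A₀ j‖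
    linarith [hnear j]
  calc ∑ j ∈ s, ‖A j‖ * w j ≤ ∑ j ∈ s, (‖A₀ j‖ + η) * w j := Finset.sum_le_sum fun j _ => mul_le_mul_of_nonneg_right (h1 j) (hw j)
    _ = ∑ j ∈ s, ‖A₀ j‖ * w j + η * ∑ j ∈ s, w j := by rw [Finset.mul_sum, ← Finset.sum_add_distrib]; exact Finset.sum_congr rfl fun j _ => by ring
    _ ≤ b + η * S := add_le_add hA₀ (mul_le_mul_of_nonneg_left hS hη)
    _ ≤ 2 * b := by linarith

end Summit.QuantumFields.YangMills.Theorems.BalabanUVNodesPortS1.G3CCT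

namespace Summit.QuantumFields.YangMills.Theorems.BalabanUVNodesPortS1

open Summit.QuantumFields.YangMills.Theorems.K0RecordFormatNames
open Literature.MathematicalPhysics.QuantumFieldTheory.Balaban1983to89
open Literature.MathematicalPhysics.QuantumFieldTheory.Balaban1983to89.Node00
open Literature.MathematicalPhysics.QuantumFieldTheory.Balaban1983to89.T4Continuum (T4Family)
open Literature.MathematicalPhysics.QuantumFieldTheory.Balaban1983to89.TreeLengthTorus (TPt)
open Literature.MathematicalPhysics.QuantumFieldTheory.Balaban1983to89.B5Prop11Lower (nsq nsq_nonneg)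

/-! ## The open neighbourhood of the record space -/

section Open

variable {F : T4Family}
variable {a₀ δ₀ c₀ γ₀ γ₁ δ₁ : ℝ} {Mc : ℕ} {α₀ α₁ ε₂₉ : ℝ} {k : ℕ}
variable {TC : (n : ℕ) → Sect2.CPair (F.P (recordK₀ F Mc k + n)) (MatA 2) → FluctIdx F k (recordK₀ F Mc k + n) → FluctIdx F k (recordK₀ F Mc k + n) → ℂ}
variable {TY : (n : ℕ) → (recordDomSys F Mc k (recordK₀ F Mc k + n)).Dom → Sect2.CPair (F.P (recordK₀ F Mc k + n)) (MatA 2) →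
  FluctIdx F k (recordK₀ F Mc k + n) → FluctIdx F k (recordK₀ F Mc k + n) → ℂ}
variable {TZY : Finset (Fin 4 → ℤ) → IntBondCfg → ((Fin 4 → ℤ) × Fin 4) × Fin 3 → ((Fin 4 → ℤ) × Fin 4) × Fin 3 → ℂ}
variable {AdM : (n : ℕ) → (Site (F.P (recordK₀ F Mc k + n)) 0 → (MatA 2)ˣ) →
  Matrix (FluctIdx F k (recordK₀ F Mc k + n)) (FluctIdx F k (recordK₀ F Mc k + n)) ℂ}
variable {AdZ : ((Fin 4 → ℤ) → (MatA 2)ˣ) → (Fin 4 → ℤ) × Fin 4 → Matrix (Fin 3) (Fin 3) ℂ}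

/-- **At a pair of the record space of `X`, every entry of every piece `T_Y`, `Y ⊆ X`, is analytic** ((P4) at `φ ∈ U^c(X) ⊆ U^c(Y)`). [cite: Balaban1987RG1, (1.16) p.263; Balaban1985Variational, Prop. 9 p.309] -/
theorem analyticAt_TY_of_mem (hP : P0CarrierClauses F a₀ δ₀ c₀ γ₀ γ₁ Mc α₀ α₁ ε₂₉ k TC TY TZY AdM AdZ) (n : ℕ)
    (X : (recordDomSys F Mc k (recordK₀ F Mc k + n)).Dom) {φ : Sect2.CPair (F.P (recordK₀ F Mc k + n)) (MatA 2)}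
    (hφ : encodeCfg F (recordK₀ F Mc k + n) φ ∈ recordUc F Mc k α₀ α₁ (recordK₀ F Mc k + n) X)
    {Y : (recordDomSys F Mc k (recordK₀ F Mc k + n)).Dom} (hY : Y.1 ⊆ X.1) (i j : FluctIdx F k (recordK₀ F Mc k + n)) :
    AnalyticAt ℂ (fun ψ : Sect2.CPair (F.P (recordK₀ F Mc k + n)) (MatA 2) => TY n Y ψ i j) φ := by
  obtain ⟨-, -, -, -, -, -, -, -, -, -, hAn, -⟩ := hP
  exact (hAn n Y φ (recordUc_antitone F hY hφ)).1 i j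

/-- ★★ **THE OPEN NEIGHBOURHOOD `O_X` OF THE RECORD SPACE WITH DEGRADED POINT CLAUSES**: under the P0-ℂ body and (P4-lat), for every volume `n` and domain `X` there is an OPEN
`O ⊇ S_X` on which the point predicate holds with `(2c₀, γ₀∕2)` and every entry of every `T_Y`, `Y ⊆ X`, is analytic (memo §5c: «O_X must be BUILT … the clauses DEGRADE gracefully»).
[cite: Balaban1987RG1, (1.16)–(1.18) p.263; Balaban1985BackgroundPropagators, (3.42) p.399; Balaban1985Variational, Prop. 9 p.309] -/
theorem exists_open_g3cPt (hP : P0CarrierClauses F a₀ δ₀ c₀ γ₀ γ₁ Mc α₀ α₁ ε₂₉ k TC TY TZY AdM AdZ) (hL : P0CarrierLatticeDecay F δ₀ c₀ δ₁ Mc α₀ α₁ k TY)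
    (hc₀ : 0 < c₀) (hγ₀ : 0 < γ₀) (n : ℕ) (X : (recordDomSys F Mc k (recordK₀ F Mc k + n)).Dom) :
    ∃ O : Set (Sect2.CPair (F.P (recordK₀ F Mc k + n)) (MatA 2)), IsOpen O ∧
      {φ | encodeCfg F (recordK₀ F Mc k + n) φ ∈ recordUc F Mc k α₀ α₁ (recordK₀ F Mc k + n) X} ⊆ O ∧
      ∀ φ ∈ O, G3CPt F Mc k (recordK₀ F Mc k + n) (TY n) (2 * c₀) (γ₀ / 2) δ₀ δ₁ X φ ∧
        ∀ Y : (recordDomSys F Mc k (recordK₀ F Mc k + n)).Dom, Y.1 ⊆ X.1 →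
          ∀ i j : FluctIdx F k (recordK₀ F Mc k + n), AnalyticAt ℂ (fun ψ : Sect2.CPair (F.P (recordK₀ F Mc k + n)) (MatA 2) => TY n Y ψ i j) φ := by
  classical
  -- the weight mass `S`, the counts `Nd`, `Ni`, and the tolerances `η Y`
  set w : FluctIdx F k (recordK₀ F Mc k + n) → FluctIdx F k (recordK₀ F Mc k + n) → ℝ := fun i j => Real.exp (δ₁ * (Site.tdist i.1.src j.1.src : ℝ)) with hw
  have hw0 : ∀ i j, 0 ≤ w i j := fun i j => (Real.exp_pos _).le
  set S : ℝ := ∑ i : FluctIdx F k (recordK₀ F Mc k + n), ∑ j : FluctIdx F k (recordK₀ F Mc k + n), w i j with hSdef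
  have hS0 : 0 ≤ S := Finset.sum_nonneg fun i _ => Finset.sum_nonneg fun j _ => hw0 i j
  have hrowS : ∀ i, ∑ j, w i j ≤ S := fun i =>
    Finset.single_le_sum (f := fun i => ∑ j, w i j) (fun i _ => Finset.sum_nonneg fun j _ => hw0 i j) (Finset.mem_univ i)
  have hcolS : ∀ j, ∑ i, w i j ≤ S := fun j => by
    rw [hSdef, Finset.sum_comm]
    exact Finset.single_le_sum (f := fun j => ∑ i, w i j) (fun j _ => Finset.sum_nonneg fun i _ => hw0 i j) (Finset.mem_univ j)
  clear_value S
  have hS1 : S + 1 ≠ 0 := by linarith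
  obtain ⟨Nd, hNd⟩ : ∃ Nd : ℝ, Nd = (Fintype.card (recordDomSys F Mc k (recordK₀ F Mc k + n)).Dom : ℝ) := ⟨_, rfl⟩
  obtain ⟨Ni, hNi⟩ : ∃ Ni : ℝ, Ni = (Fintype.card (NonB0Idx F k (recordK₀ F Mc k + n)) : ℝ) := ⟨_, rfl⟩
  have hNd0 : 0 ≤ Nd := by rw [hNd]; positivity
  have hNi0 : 0 ≤ Ni := by rw [hNi]; positivity
  obtain ⟨ε, hεdef⟩ : ∃ ε : ℝ, ε = γ₀ / (2 * ((Nd + 1) * (Ni + 1))) := ⟨_, rfl⟩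
  have hε0 : 0 < ε := by rw [hεdef]; positivity
  obtain ⟨η, hηdef⟩ : ∃ η : (recordDomSys F Mc k (recordK₀ F Mc k + n)).Dom → ℝ,
      η = fun Y => min (c₀ * Real.exp (-(δ₀ * (recordDomSys F Mc k (recordK₀ F Mc k + n)).dj Y)) / (S + 1)) (ε / (Nd + 1)) := ⟨_, rfl⟩
  have hη0 : ∀ Y, 0 < η Y := fun Y => by
    rw [hηdef]
    exact lt_min (div_pos (by positivity) (by linarith)) (div_pos hε0 (by linarith))
  have hη1 : ∀ Y, η Y * S ≤ c₀ * Real.exp (-(δ₀ * (recordDomSys F Mc k (recordK₀ F Mc k + n)).dj Y)) := fun Y => by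
    have h : η Y ≤ c₀ * Real.exp (-(δ₀ * (recordDomSys F Mc k (recordK₀ F Mc k + n)).dj Y)) / (S + 1) := by rw [hηdef]; exact min_le_left _ _
    have hpos : 0 < c₀ * Real.exp (-(δ₀ * (recordDomSys F Mc k (recordK₀ F Mc k + n)).dj Y)) := by positivity
    calc η Y * S ≤ (c₀ * Real.exp (-(δ₀ * (recordDomSys F Mc k (recordK₀ F Mc k + n)).dj Y)) / (S + 1)) * S := mul_le_mul_of_nonneg_right h hS0
      _ ≤ (c₀ * Real.exp (-(δ₀ * (recordDomSys F Mc k (recordK₀ F Mc k + n)).dj Y)) / (S + 1)) * (S + 1) :=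
          mul_le_mul_of_nonneg_left (by linarith) (div_nonneg hpos.le (by linarith))
      _ = c₀ * Real.exp (-(δ₀ * (recordDomSys F Mc k (recordK₀ F Mc k + n)).dj Y)) := div_mul_cancel₀ _ hS1
  have hη2 : ∀ Y, η Y ≤ ε / (Nd + 1) := fun Y => by rw [hηdef]; exact min_le_right _ _
  -- the local property at a base point
  set P : Sect2.CPair (F.P (recordK₀ F Mc k + n)) (MatA 2) → Sect2.CPair (F.P (recordK₀ F Mc k + n)) (MatA 2) → Prop := fun φ₀ φ =>
    ∀ Y : (recordDomSys F Mc k (recordK₀ F Mc k + n)).Dom, Y.1 ⊆ X.1 → ∀ i j : FluctIdx F k (recordK₀ F Mc k + n),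
      ‖TY n Y φ i j - TY n Y φ₀ i j‖ ≤ η Y ∧ AnalyticAt ℂ (fun ψ : Sect2.CPair (F.P (recordK₀ F Mc k + n)) (MatA 2) => TY n Y ψ i j) φ with hPdef
  have hPnhds : ∀ φ₀ : Sect2.CPair (F.P (recordK₀ F Mc k + n)) (MatA 2), encodeCfg F (recordK₀ F Mc k + n) φ₀ ∈ recordUc F Mc k α₀ α₁ (recordK₀ F Mc k + n) X → {φ | P φ₀ φ} ∈ 𝓝 φ₀ := by
    intro φ₀ hφ₀
    have hev : ∀ᶠ φ in 𝓝 φ₀, P φ₀ φ := by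
      refine Filter.eventually_all.2 fun Y => ?_
      by_cases hY : Y.1 ⊆ X.1
      · have h : ∀ᶠ φ in 𝓝 φ₀, ∀ i j : FluctIdx F k (recordK₀ F Mc k + n),
            ‖TY n Y φ i j - TY n Y φ₀ i j‖ ≤ η Y ∧ AnalyticAt ℂ (fun ψ : Sect2.CPair (F.P (recordK₀ F Mc k + n)) (MatA 2) => TY n Y ψ i j) φ := by
          refine Filter.eventually_all.2 fun i => Filter.eventually_all.2 fun j => ?_
          have han : AnalyticAt ℂ (fun ψ : Sect2.CPair (F.P (recordK₀ F Mc k + n)) (MatA 2) => TY n Y ψ i j) φ₀ := analyticAt_TY_of_mem hP n X hφ₀ hY i j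
          have hct : ContinuousAt (fun ψ : Sect2.CPair (F.P (recordK₀ F Mc k + n)) (MatA 2) => TY n Y ψ i j) φ₀ := han.continuousAt
          have h1 : ∀ᶠ φ in 𝓝 φ₀, ‖TY n Y φ i j - TY n Y φ₀ i j‖ ≤ η Y := by
            have := hct.tendsto.eventually (Metric.closedBall_mem_nhds (TY n Y φ₀ i j) (hη0 Y))
            refine this.mono fun φ hφ => ?_
            have hφ' := Metric.mem_closedBall.1 hφ
            rwa [dist_eq_norm] at hφ'
          exact h1.and han.eventually_analyticAt
        exact h.mono fun φ hφ _ => hφ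
      · exact Filter.Eventually.of_forall fun φ h => absurd h hY
    exact hev
  -- the open set
  refine ⟨⋃ φ₀ ∈ {φ | encodeCfg F (recordK₀ F Mc k + n) φ ∈ recordUc F Mc k α₀ α₁ (recordK₀ F Mc k + n) X}, interior {φ | P φ₀ φ},
    isOpen_biUnion fun _ _ => isOpen_interior,
    fun φ₀ hφ₀ => Set.mem_biUnion hφ₀ (mem_interior_iff_mem_nhds.2 (hPnhds φ₀ hφ₀)), fun φ hφ => ?_⟩
  obtain ⟨φ₀, hφ₀, hφin⟩ := Set.mem_iUnion₂.1 hφ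
  have hPφ : P φ₀ φ := interior_subset hφin
  have hpt₀ : G3CPt F Mc k (recordK₀ F Mc k + n) (TY n) c₀ γ₀ δ₀ δ₁ X φ₀ := g3cPt_of_mem hP hL n X hφ₀
  refine ⟨⟨fun Y hY => ⟨fun i => ?_, fun j => ?_⟩, fun Z hZ z => ?_⟩, fun Y hY i j => (hPφ Y hY i j).2⟩
  · -- weighted rows
    have h := G3CCT.weightedRowSum_le_of_near Finset.univ (fun j => TY n Y φ i j) (fun j => TY n Y φ₀ i j) (fun j => w i j) (fun j => hw0 i j)
      (hη0 Y).le (hrowS i) ((hpt₀.1 Y hY).1 i) (fun j => (hPφ Y hY i j).1) (hη1 Y)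
    simpa only [hw, mul_assoc] using h
  · -- weighted columns
    have h := G3CCT.weightedRowSum_le_of_near Finset.univ (fun i => TY n Y φ i j) (fun i => TY n Y φ₀ i j) (fun i => w i j) (fun i => hw0 i j)
      (hη0 Y).le (hcolS j) ((hpt₀.1 Y hY).2 j) (fun i => (hPφ Y hY i j).1) (hη1 Y)
    simpa only [hw, mul_assoc] using h
  · -- coercivity of the block `Z ⊆ X`
    have hD : ∀ a b : {i : NonB0Idx F k (recordK₀ F Mc k + n) // g3cInDom F Mc k (recordK₀ F Mc k + n) Z i},
        ‖(g3cLocOp F Mc k (recordK₀ F Mc k + n) (TY n) Z φ).submatrix Subtype.val Subtype.val a b -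
          (g3cLocOp F Mc k (recordK₀ F Mc k + n) (TY n) Z φ₀).submatrix Subtype.val Subtype.val a b‖ ≤ ε := by
      intro a b
      rw [Matrix.submatrix_apply, Matrix.submatrix_apply, g3cLocOp, g3cLocOp, Matrix.of_apply, Matrix.of_apply, ← Finset.sum_sub_distrib]
      refine (norm_sum_le _ _).trans ?_
      calc ∑ Y ∈ Finset.univ.filter (fun Y : (recordDomSys F Mc k (recordK₀ F Mc k + n)).Dom => Y.1 ⊆ Z.1), ‖TY n Y φ a.1.1 b.1.1 - TY n Y φ₀ a.1.1 b.1.1‖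
          ≤ ∑ Y ∈ Finset.univ.filter (fun Y : (recordDomSys F Mc k (recordK₀ F Mc k + n)).Dom => Y.1 ⊆ Z.1), ε / (Nd + 1) :=
            Finset.sum_le_sum fun Y hY' => ((hPφ Y ((Finset.mem_filter.1 hY').2.trans hZ) a.1.1 b.1.1).1).trans (hη2 Y)
        _ = ((Finset.univ.filter (fun Y : (recordDomSys F Mc k (recordK₀ F Mc k + n)).Dom => Y.1 ⊆ Z.1)).card : ℝ) * (ε / (Nd + 1)) := by
            rw [Finset.sum_const, nsmul_eq_mul]
        _ ≤ Nd * (ε / (Nd + 1)) := by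
            refine mul_le_mul_of_nonneg_right ?_ (div_nonneg hε0.le (by linarith))
            rw [hNd]; exact_mod_cast Finset.card_filter_le _ _
        _ = ε * (Nd / (Nd + 1)) := by ring
        _ ≤ ε * 1 := mul_le_mul_of_nonneg_left (div_le_one_of_le₀ (by linarith) (by linarith)) hε0.le
        _ = ε := mul_one ε
    have hεγ : ε * Fintype.card {i : NonB0Idx F k (recordK₀ F Mc k + n) // g3cInDom F Mc k (recordK₀ F Mc k + n) Z i} ≤ γ₀ / 2 := by
      have hcard : (Fintype.card {i : NonB0Idx F k (recordK₀ F Mc k + n) // g3cInDom F Mc k (recordK₀ F Mc k + n) Z i} : ℝ) ≤ Ni := by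
        rw [hNi]; exact_mod_cast Fintype.card_subtype_le _
      calc ε * Fintype.card {i : NonB0Idx F k (recordK₀ F Mc k + n) // g3cInDom F Mc k (recordK₀ F Mc k + n) Z i} ≤ ε * (Ni + 1) := mul_le_mul_of_nonneg_left (by linarith) hε0.le
        _ = γ₀ / (2 * (Nd + 1)) := by rw [hεdef]; field_simp
        _ ≤ γ₀ / 2 := div_le_div_of_nonneg_left hγ₀.le (by norm_num) (by linarith)
    exact G3CCT.reCoercive_of_near
      ((g3cLocOp F Mc k (recordK₀ F Mc k + n) (TY n) Z φ₀).submatrix Subtype.val Subtype.val)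
      ((g3cLocOp F Mc k (recordK₀ F Mc k + n) (TY n) Z φ).submatrix Subtype.val Subtype.val) hε0.le (hpt₀.2 Z hZ) hD hεγ z

end Open

end Summit.QuantumFields.YangMills.Theorems.BalabanUVNodesPortS1

end
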